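import Summits.KontsevichZagierPeriods.Zeta5Search.Barrier.ConeGammaShift
import Summits.KontsevichZagierPeriods.Zeta5Search.Barrier.ConeGammaPeriod

/-!
# ζ(5) search — BARRIER: the MODEL saving rate `Φ` is NOT `S₇`-invariant — the defect is one explicit integral

HONEST FRAMING (cell `pub-zeta5`): systematic search; no irrationality claim unless kernel-certified. MODEL objects
under Brown–Zudilin's (28)+(30) accounting ([BZ22] = arXiv:2210.03391; (28) observed, not proved); nothing here is a
statement about `ζ(5)`, about `γ`, or about the cone's supremum (C2 = `BarrierC2` OPEN). No number or sentence of
record moves: every `γ` of record is a class function (below), every `Φ`/`C₁`/`C₀` value of record was computed at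
its stated representative. Records in print UNMOVED. Prover P2 g20 (self-selected Lean-only item of the P2 lineage,
second item; plan INBOX 2026-08-26).

BZ's group `G ≅ S₇` acts on directions by permuting `s₁,…,s₇` (`permAct`). The (29)–(30) saving takes the given
parameter vector as its BASE: `N_a(u) = max_σ Σ_{i∈F}(⌊h_i(a)u⌋ − ⌊h_i(σa)u⌋)`. Changing the base to `g·a` re-indexes
the max and moves ONLY the base term, so

* `permS_permS`, `torusTerm_permS`, **`torusN_permS`** — `𝒩(g·θ) = 𝒩(θ) − torusTerm θ g` on `ℝ⁸`;
* `sParam_permAct`, **`savingN_permAct_eq`** — on the closed box, `N_{g·a}(u) = N_a(u) − torusTerm(u·s(a)) g`;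
* `torusTerm_line_eq_sum` — `torusTerm(u·s(a)) g = Σ_{i∈F}(⌊u·h_i(a)⌋ − ⌊u·h_i(g·a)⌋)`;
  `sum_FIdx_h28_permAct` — `Σ_{i∈F} h_i(g·a) = Σ_{i∈F} h_i(a)` (so the defect integrand is bounded and vanishes
  near `u = 0`; it is NOT zero: `F` is not `S₇`-stable as a set);
* **`phi30_permAct_sub_eq_integral`** — `Φ(g·a) − Φ(a) = ∫_{(0,∞)} Σ_{i∈F}(⌊u·h_i(g·a)⌋ − ⌊u·h_i(a)⌋)·u⁻² du`,
  with the integrand integrable (`integrableOn_S7defect`).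
The closed form of the right-hand side — the F-ENTROPY COCYCLE `Σ_{i∈F}[h_i(ga) log h_i(ga) − h_i(a) log h_i(a)]`,
via `∫₀^∞ (⌊xu⌋ − x⌊u⌋)u⁻² du = x log x` — is the sequel `ConeGammaS7Cocycle`. NOT here and NOT claimed anywhere
in the kernel: the matching shift of the critical values `C₁, C₀, log|λ₁|` under `S₇` (seat numerics only, to 1e−8
at the record direction), hence `γ`'s `S₇`-invariance; anything about the cone's sup, C2, S-E or `ζ(5)`.
-/

noncomputable section

open Set MeasureTheory
open scoped Topology

namespace Summit.KontsevichZagierPeriods.Zeta5Search.Barrier.ConeGamma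

/-! ### The `S₇` action on the torus saving function -/

/-- Composition of the action on `ℝ⁸`: `τ·(g·θ) = (g τ)·θ` (`permS` pulls back along the permutation). -/
theorem permS_permS (g τ : Equiv.Perm (Fin 7)) (θ : Fin 8 → ℝ) : permS τ (permS g θ) = permS (g * τ) θ := by
  ext i
  refine Fin.cases ?_ (fun j => ?_) i
  · simp [permS]
  · simp [permS, Equiv.Perm.mul_apply]

/-- Changing the base point of a torus term: `torusTerm (g·θ) τ = torusTerm θ (gτ) − torusTerm θ g`. -/
theorem torusTerm_permS (g τ : Equiv.Perm (Fin 7)) (θ : Fin 8 → ℝ) :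
    torusTerm (permS g θ) τ = torusTerm θ (g * τ) - torusTerm θ g := by
  unfold torusTerm
  rw [permS_permS]
  simp only [Finset.sum_sub_distrib]
  ring

/-- **`𝒩(g·θ) = 𝒩(θ) − torusTerm θ g`**: the max over `S₇` re-indexes (`τ ↦ gτ`), only the base term moves. -/
theorem torusN_permS (g : Equiv.Perm (Fin 7)) (θ : Fin 8 → ℝ) :
    torusN (permS g θ) = torusN θ - torusTerm θ g := by
  unfold torusN
  apply le_antisymm
  · refine Finset.sup'_le _ _ fun τ _ => ?_
    rw [torusTerm_permS]
    have := Finset.le_sup' (torusTerm θ) (Finset.mem_univ (g * τ))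
    linarith
  · obtain ⟨τ₀, -, hτ₀⟩ := Finset.exists_mem_eq_sup' Finset.univ_nonempty (torusTerm θ)
    rw [hτ₀]
    have h := Finset.le_sup' (torusTerm (permS g θ)) (Finset.mem_univ (g⁻¹ * τ₀))
    rw [torusTerm_permS, mul_inv_cancel_left] at h
    linarith

/-- The symmetric parameters of `g·a` are the permuted parameters of `a`. -/
theorem sParam_permAct (g : Equiv.Perm (Fin 7)) (a : Dir) : sParam (permAct g a) = permS g (sParam a) := by
  simp [permAct, sParam_aOfS]

/-- **Base change of BZ's saving on the closed box**: `N_{g·a}(u) = N_a(u) − torusTerm(u·s(a)) g`. -/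
theorem savingN_permAct_eq {a : Dir} (ha : BZBox a) (g : Equiv.Perm (Fin 7)) (u : ℝ) :
    savingN (permAct g a) u = savingN a u - torusTerm (u • sParam a) g := by
  rw [savingN_eq_torusN_of_BZBox (BZBox_permAct ha g), savingN_eq_torusN_of_BZBox ha, sParam_permAct,
    ← permS_smul, torusN_permS]

/-- The base term along the orbit, in the tree's `h28` vocabulary:
`torusTerm(u·s(a)) g = Σ_{i∈F}(⌊u·h_i(a)⌋ − ⌊u·h_i(g·a)⌋)`. -/
theorem torusTerm_line_eq_sum (a : Dir) (g : Equiv.Perm (Fin 7)) (u : ℝ) :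
    (torusTerm (u • sParam a) g : ℝ) = ∑ i ∈ FIdx, ((⌊u * h28 a i⌋ : ℝ) - ⌊u * h28 (permAct g a) i⌋) := by
  unfold torusTerm
  push_cast
  refine Finset.sum_congr rfl fun i _ => ?_
  rw [phiForm_smul_sParam, phiForm_permS_smul_sParam]

/-- `Σ_{i∈F} h_i` is `S₇`-invariant: `Σ_{i∈F} h_i(g·a) = Σ_{i∈F} h_i(a)` (`= 2s₀ + 4Σ s_j`). -/
theorem sum_FIdx_h28_permAct (g : Equiv.Perm (Fin 7)) (a : Dir) :
    ∑ i ∈ FIdx, h28 (permAct g a) i = ∑ i ∈ FIdx, h28 a i := by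
  rw [sum_FIdx_h28, sum_FIdx_h28, sParam_permAct]
  simp only [permS_apply, liftPerm_zero, liftPerm_succ]
  congr 1
  congr 1
  exact Equiv.sum_comp g (fun j => sParam a j.succ)

/-! ### The defect of `Φ` under `S₇` as one integral -/

/-- The defect integrand `u ↦ Σ_{i∈F}(⌊u·h_i(g·a)⌋ − ⌊u·h_i(a)⌋)·u⁻²` is integrable on `(0, ∞)` (difference of the
two integrable saving integrands). -/
theorem integrableOn_S7defect {a : Dir} (ha : BZBox a) (g : Equiv.Perm (Fin 7)) :
    IntegrableOn (fun u : ℝ => (∑ i ∈ FIdx, ((⌊u * h28 (permAct g a) i⌋ : ℝ) - ⌊u * h28 a i⌋)) / u ^ 2)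
      (Ioi 0) := by
  have h := (integrableOn_savingN_div_sq (BZBox_permAct ha g)).sub (integrableOn_savingN_div_sq ha)
  refine h.congr_fun (fun u _ => ?_) measurableSet_Ioi
  simp only [Pi.sub_apply]
  rw [← sub_div, savingN_permAct_eq ha, Int.cast_sub, torusTerm_line_eq_sum]
  have hnum : (savingN a u : ℝ) - ∑ i ∈ FIdx, ((⌊u * h28 a i⌋ : ℝ) - ⌊u * h28 (permAct g a) i⌋) - savingN a u
      = ∑ i ∈ FIdx, ((⌊u * h28 (permAct g a) i⌋ : ℝ) - ⌊u * h28 a i⌋) := by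
    simp only [Finset.sum_sub_distrib]
    ring
  rw [hnum]

/-- **`Φ` is not a class function: the defect under `g ∈ S₇` is ONE explicit integral.** For `a` in the closed box,
`Φ(g·a) − Φ(a) = ∫_{(0,∞)} Σ_{i∈F}(⌊u·h_i(g·a)⌋ − ⌊u·h_i(a)⌋)·u⁻² du`. (Closed form = the F-entropy cocycle:
sequel `ConeGammaS7Cocycle`.) -/
theorem phi30_permAct_sub_eq_integral {a : Dir} (ha : BZBox a) (g : Equiv.Perm (Fin 7)) :
    phi30 (permAct g a) - phi30 a
      = ∫ u in Ioi (0 : ℝ), (∑ i ∈ FIdx, ((⌊u * h28 (permAct g a) i⌋ : ℝ) - ⌊u * h28 a i⌋)) / u ^ 2 := by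
  unfold phi30
  rw [← integral_sub (integrableOn_savingN_div_sq (BZBox_permAct ha g)) (integrableOn_savingN_div_sq ha)]
  refine setIntegral_congr_fun measurableSet_Ioi fun u _ => ?_
  rw [← sub_div, savingN_permAct_eq ha, Int.cast_sub, torusTerm_line_eq_sum]
  have hnum : (savingN a u : ℝ) - ∑ i ∈ FIdx, ((⌊u * h28 a i⌋ : ℝ) - ⌊u * h28 (permAct g a) i⌋) - savingN a u
      = ∑ i ∈ FIdx, ((⌊u * h28 (permAct g a) i⌋ : ℝ) - ⌊u * h28 a i⌋) := by
    simp only [Finset.sum_sub_distrib]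
    ring
  rw [hnum]

end Summit.KontsevichZagierPeriods.Zeta5Search.Barrier.ConeGamma

end
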